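import Literature.GroupTheory.CombinatorialGroupTheory.ReidemeisterSchreierCovering
import Literature.GroupTheory.CombinatorialGroupTheory.QuadraticSystems
import Mathlib.Data.Fintype.Card
import HarnessLib

/-!
# The covering system of a one-relator presentation: lifted faces and their vertices

Topic `Literature/GroupTheory/CombinatorialGroupTheory`; continues `ReidemeisterSchreierCovering.lean`
and `QuadraticSystems.lean`.  For an action `act : F(X) → Sym(A)` (think: the cosets of a subgroup
of a one-relator group `⟨X ∣ R₀⟩`) and a word `R₀` over `X`, the covering 2-complex has the edge
letters `(X × A) × Bool` (`((x, a), true)` is the edge `(x, a) : a ⟶ x·a`, `((x, a), false)` the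
same edge reversed) and one face for each vertex `b : A`, whose boundary word `liftAt R₀ b` is the
lift of `R₀` ending at `b` — so that `pathWord (mk R₀) b = mk (liftAt R₀ b)` is exactly the lifted
relator of the covering presentation (ZVC 2.2.2–2.2.4, §4.14).  We prove:

* `mk_liftAt` — `FreeGroup.mk (liftAt R₀ b) = pathWord act (FreeGroup.mk R₀) b`;
* `nodup_faces_flatten`, `mem_faces_flatten` — when `R₀` is duplicate-free and uses every letter,
  the letters of all faces are pairwise distinct and exhaust `(X × A) × Bool` (every edge of the
  covering lies on exactly two face boundaries, once with each orientation);
* `fin_sysPerm`, `proj_sysPerm`, `sameCycle_sysPerm_faces_iff` — the vertex permutation of the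
  system of faces (`sysPerm`, ZVC 3.1.2) preserves the end vertex `fin` of a letter and covers the
  vertex permutation of `R₀`; hence if `R₀` is a one-vertex word (`VertexTransitive R₀`) the cycles
  of the system are exactly the fibres of `fin`: **the covering complex has one vertex over each
  point of `A`** (`|A|` vertices, `|X|·|A|` edges, `|A|` faces).

## References

* H. Zieschang, E. Vogt, H.-D. Coldewey, *Surfaces and Planar Discontinuous Groups*, LNM 835,
  Springer 1980, 2.2.2–2.2.4, 3.1.2, 4.14.1. [ZieschangVogtColdewey1980]
-/

namespace Literature.GroupTheory.CombinatorialGroupTheory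

open List Equiv Equiv.Perm

namespace CoveringPresentation

universe u v

variable {X : Type u} {A : Type v} (act : FreeGroup X →* Equiv.Perm A)

/-! ### Edge letters -/

/-- The end vertex of an edge letter: `((x, a), true) : a ⟶ x·a`, `((x, a), false) : x·a ⟶ a`.
[cite: ZieschangVogtColdewey1980, 2.2.2] -/
def fin : (X × A) × Bool → A
  | ((x, a), true) => act (FreeGroup.of x) a
  | ((_, a), false) => a

/-- The initial vertex of an edge letter. [cite: ZieschangVogtColdewey1980, 2.2.2] -/
def ini : (X × A) × Bool → A
  | ((_, a), true) => a
  | ((x, a), false) => act (FreeGroup.of x) a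

/-- The base letter under an edge letter. [cite: ZieschangVogtColdewey1980, 2.2.2] -/
def proj : (X × A) × Bool → X × Bool := fun l => (l.1.1, l.2)

/-- The reversed edge starts where the edge ends. [cite: ZieschangVogtColdewey1980, 2.2.2] -/
@[simp] theorem fin_bar (l : (X × A) × Bool) : fin act (bar l) = ini act l := by
  obtain ⟨⟨x, a⟩, _ | _⟩ := l <;> rfl

/-- The reversed edge ends where the edge starts. [cite: ZieschangVogtColdewey1980, 2.2.2] -/
@[simp] theorem ini_bar (l : (X × A) × Bool) : ini act (bar l) = fin act l := by
  obtain ⟨⟨x, a⟩, _ | _⟩ := l <;> rfl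

omit act in
/-- Reversal commutes with the projection. [cite: ZieschangVogtColdewey1980, 2.2.2] -/
@[simp] theorem proj_bar (l : (X × A) × Bool) : proj (bar l) = bar (proj l) := rfl

/-- **An edge letter is determined by its base letter and its end vertex.**
[cite: ZieschangVogtColdewey1980, 2.2.2] -/
theorem ext_of_proj_fin {l m : (X × A) × Bool} (hp : proj l = proj m) (hf : fin act l = fin act m) :
    l = m := by
  obtain ⟨⟨x, a⟩, s⟩ := l
  obtain ⟨⟨y, b⟩, t⟩ := m
  simp only [proj, Prod.mk.injEq] at hp
  obtain ⟨rfl, rfl⟩ := hp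
  cases s
  · simp only [fin] at hf; rw [hf]
  · simp only [fin] at hf; rw [(act (FreeGroup.of x)).injective hf]

/-- The edge letter over the base letter `β` ENDING at the vertex `c`.
[cite: ZieschangVogtColdewey1980, 2.2.2] -/
def edgeLetter : X × Bool → A → (X × A) × Bool
  | (x, true), c => ((x, act (FreeGroup.of x)⁻¹ c), true)
  | (x, false), c => ((x, c), false)

/-- `edgeLetter β c` ends at `c`. [cite: ZieschangVogtColdewey1980, 2.2.2] -/
@[simp] theorem fin_edgeLetter (β : X × Bool) (c : A) : fin act (edgeLetter act β c) = c := by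
  obtain ⟨x, _ | _⟩ := β
  · rfl
  · simp only [edgeLetter, fin]
    rw [map_inv]
    exact (act (FreeGroup.of x)).apply_symm_apply c

/-- `edgeLetter β c` starts at `β⁻¹ c`. [cite: ZieschangVogtColdewey1980, 2.2.2] -/
theorem ini_edgeLetter (β : X × Bool) (c : A) :
    ini act (edgeLetter act β c) = act (FreeGroup.mk [β])⁻¹ c := by
  obtain ⟨x, _ | _⟩ := β
  · simp only [edgeLetter, ini]
    have : FreeGroup.mk [(x, false)] = (FreeGroup.of x)⁻¹ := rfl
    rw [this, inv_inv]
  · rfl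

/-- `edgeLetter β c` lies over `β`. [cite: ZieschangVogtColdewey1980, 2.2.2] -/
@[simp] theorem proj_edgeLetter (β : X × Bool) (c : A) : proj (edgeLetter act β c) = β := by
  obtain ⟨x, _ | _⟩ := β <;> rfl

/-- The edge letter is the path word of its base letter. [cite: ZieschangVogtColdewey1980, 2.2.2] -/
theorem mk_edgeLetter (β : X × Bool) (c : A) :
    FreeGroup.mk [edgeLetter act β c] = pathWord act (FreeGroup.mk [β]) c := by
  obtain ⟨x, _ | _⟩ := β
  · have e : FreeGroup.mk [(x, false)] = (FreeGroup.of x)⁻¹ := rfl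
    rw [e, pathWord_inv, pathWord_of, map_inv]
    simp only [edgeLetter]
    rw [show ((act (FreeGroup.of x))⁻¹ ((act (FreeGroup.of x)) c)) = c from
      (act (FreeGroup.of x)).symm_apply_apply c]
    rfl
  · have e : FreeGroup.mk [(x, true)] = FreeGroup.of x := rfl
    rw [e, pathWord_of]; rfl

/-! ### Lifted faces -/

/-- **The lift of a word ending at a vertex**: the boundary word of the face of the covering over
the face with boundary word `L`, read so that the path ends at `c`.
[cite: ZieschangVogtColdewey1980, 2.2.3] -/
def liftAt : List (X × Bool) → A → List ((X × A) × Bool)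
  | [], _ => []
  | β :: L, c => edgeLetter act β c :: liftAt L (act (FreeGroup.mk [β])⁻¹ c)

/-- **The lifted face is the lifted relator**: `mk (liftAt L c) = pathWord (mk L) c`.
[cite: ZieschangVogtColdewey1980, 2.2.3] -/
theorem mk_liftAt : ∀ (L : List (X × Bool)) (c : A),
    FreeGroup.mk (liftAt act L c) = pathWord act (FreeGroup.mk L) c
  | [], c => by
    rw [liftAt, show (FreeGroup.mk ([] : List (X × Bool))) = 1 from rfl, pathWord_one]; rfl
  | β :: L, c => by
    have e : FreeGroup.mk (β :: L) = FreeGroup.mk [β] * FreeGroup.mk L := by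
      rw [FreeGroup.mul_mk]; rfl
    rw [liftAt, ← singleton_append, ← FreeGroup.mul_mk, mk_edgeLetter, mk_liftAt L, e, pathWord_mul]

/-- The lifted face lies over the word. [cite: ZieschangVogtColdewey1980, 2.2.3] -/
theorem map_proj_liftAt : ∀ (L : List (X × Bool)) (c : A), (liftAt act L c).map proj = L
  | [], _ => rfl
  | β :: L, c => by rw [liftAt, map_cons, proj_edgeLetter, map_proj_liftAt L]

/-- The lifted face has the length of the word. [cite: ZieschangVogtColdewey1980, 2.2.3] -/
theorem length_liftAt (L : List (X × Bool)) (c : A) : (liftAt act L c).length = L.length := by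
  rw [← length_map (f := proj), map_proj_liftAt]

/-- A lift of a duplicate-free word is duplicate-free. [cite: ZieschangVogtColdewey1980, 2.2.3] -/
theorem nodup_liftAt {L : List (X × Bool)} (hd : L.Nodup) (c : A) : (liftAt act L c).Nodup :=
  Nodup.of_map proj (by rw [map_proj_liftAt]; exact hd)

/-- The first letter of a lift ending at `c` ends at `c`. [cite: ZieschangVogtColdewey1980, 2.2.3] -/
theorem fin_head_liftAt {L : List (X × Bool)} (hL : L ≠ []) (c : A) (h : liftAt act L c ≠ []) :
    fin act ((liftAt act L c).head h) = c := by
  obtain ⟨β, L, rfl⟩ := exists_cons_of_ne_nil hL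
  simp [liftAt]

/-- The last letter of the lift of `L` ending at `c` starts at `L⁻¹ c`.
[cite: ZieschangVogtColdewey1980, 2.2.3] -/
theorem ini_getLast_liftAt : ∀ {L : List (X × Bool)} (c : A) (h : liftAt act L c ≠ []),
    ini act ((liftAt act L c).getLast h) = act (FreeGroup.mk L)⁻¹ c
  | [], _, h => absurd rfl h
  | [β], c, h => by simp [liftAt, ini_edgeLetter]
  | β :: γ :: L, c, h => by
    have h' : liftAt act (γ :: L) (act (FreeGroup.mk [β])⁻¹ c) ≠ [] := by simp [liftAt]
    have hl : (liftAt act (β :: γ :: L) c).getLast h =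
        (liftAt act (γ :: L) (act (FreeGroup.mk [β])⁻¹ c)).getLast h' := getLast_cons h'
    rw [hl, ini_getLast_liftAt _ h']
    have e : FreeGroup.mk (β :: γ :: L) = FreeGroup.mk [β] * FreeGroup.mk (γ :: L) := by
      rw [FreeGroup.mul_mk]; rfl
    rw [e, mul_inv_rev, map_mul, Perm.mul_apply]

/-- The first letter of a lift lies over the first letter. [cite: ZieschangVogtColdewey1980, 2.2.3] -/
theorem proj_head_liftAt {L : List (X × Bool)} (c : A) (h : liftAt act L c ≠ []) (hL : L ≠ []) :
    proj ((liftAt act L c).head h) = L.head hL := by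
  obtain ⟨β, L, rfl⟩ := exists_cons_of_ne_nil hL
  simp [liftAt]

/-- The last letter of a lift lies over the last letter. [cite: ZieschangVogtColdewey1980, 2.2.3] -/
theorem proj_getLast_liftAt : ∀ {L : List (X × Bool)} (c : A) (h : liftAt act L c ≠ []) (hL : L ≠ []),
    proj ((liftAt act L c).getLast h) = L.getLast hL
  | [], _, _, hL => absurd rfl hL
  | [β], c, h, _ => by simp [liftAt]
  | β :: γ :: L, c, h, _ => by
    have h' : liftAt act (γ :: L) (act (FreeGroup.mk [β])⁻¹ c) ≠ [] := by simp [liftAt]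
    have hl : (liftAt act (β :: γ :: L) c).getLast h =
        (liftAt act (γ :: L) (act (FreeGroup.mk [β])⁻¹ c)).getLast h' := getLast_cons h'
    rw [hl, proj_getLast_liftAt _ h' (cons_ne_nil γ L), getLast_cons (cons_ne_nil γ L)]

/-- Consecutive letters of a lift: the later letter ends where the earlier one starts.
[cite: ZieschangVogtColdewey1980, 2.2.3] -/
theorem fin_eq_ini_of_liftAt_eq : ∀ (L : List (X × Bool)) (c : A) (P Q : List ((X × A) × Bool))
    (e e' : (X × A) × Bool), liftAt act L c = P ++ e :: e' :: Q → fin act e' = ini act e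
  | [], c, P, Q, e, e', h => by simp [liftAt] at h
  | [β], c, P, Q, e, e', h => by
    have : (P ++ e :: e' :: Q).length = 1 := by rw [← h]; rfl
    simp at this; omega
  | β :: γ :: L, c, P, Q, e, e', h => by
    rcases P with _ | ⟨p, P⟩
    · simp only [liftAt, nil_append, cons.injEq] at h
      obtain ⟨rfl, h2, -⟩ := h
      rw [← h2, fin_edgeLetter, ini_edgeLetter]
    · simp only [liftAt, cons_append, cons.injEq] at h
      exact fin_eq_ini_of_liftAt_eq (γ :: L) _ P Q e e' h.2

/-- **Two lifts of a duplicate-free word sharing a letter end at the same vertex.**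
[cite: ZieschangVogtColdewey1980, 2.2.3] -/
theorem eq_of_mem_liftAt : ∀ {L : List (X × Bool)} (_ : L.Nodup) {c c' : A} {l : (X × A) × Bool},
    l ∈ liftAt act L c → l ∈ liftAt act L c' → c = c'
  | [], _, c, c', l, h, _ => by simp [liftAt] at h
  | β :: L, hd, c, c', l, h, h' => by
    simp only [liftAt, mem_cons] at h h'
    have hβ : β ∉ L := (nodup_cons.1 hd).1
    have key : ∀ {d : A} {m : (X × A) × Bool}, m ∈ liftAt act L d → proj m ∈ L := fun {d m} hl => by
      rw [← map_proj_liftAt act L d]; exact mem_map.2 ⟨m, hl, rfl⟩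
    rcases h with rfl | h <;> rcases h' with h' | h'
    · have := congrArg (fin act) h'
      rw [fin_edgeLetter, fin_edgeLetter] at this
      exact this
    · exact absurd (by simpa using key h') hβ
    · rw [h'] at h
      exact absurd (by simpa using key h) hβ
    · have := eq_of_mem_liftAt (nodup_cons.1 hd).2 h h'
      exact (act (FreeGroup.mk [β])⁻¹).injective this

/-! ### The system of all lifted faces -/

section System

variable [Fintype A] (R₀ : List (X × Bool))

/-- **The faces of the covering**: the lifts of `R₀` ending at each vertex of `A`.
[cite: ZieschangVogtColdewey1980, 2.2.4] -/
noncomputable def faces : List (List ((X × A) × Bool)) := (Finset.univ : Finset A).toList.map (liftAt act R₀)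

variable {R₀}

/-- Membership in the faces. [cite: ZieschangVogtColdewey1980, 2.2.4] -/
theorem mem_faces {F : List ((X × A) × Bool)} : F ∈ faces act R₀ ↔ ∃ b, F = liftAt act R₀ b := by
  simp [faces, eq_comm]

/-- The letters of all lifted faces are pairwise distinct (for duplicate-free `R₀`).
[cite: ZieschangVogtColdewey1980, 2.2.4] -/
theorem nodup_faces_flatten (hd : R₀.Nodup) : (faces act R₀).flatten.Nodup := by
  rw [nodup_flatten]
  refine ⟨fun F hF => ?_, ?_⟩
  · obtain ⟨b, rfl⟩ := (mem_faces act).1 hF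
    exact nodup_liftAt act hd b
  · rw [faces]
    exact List.Pairwise.map (R := (· ≠ ·)) _
      (fun b b' hne l hl hl' => hne (eq_of_mem_liftAt act hd hl hl')) (Finset.nodup_toList _)

/-- The number of letters of all faces is `|A| · |R₀|`. [cite: ZieschangVogtColdewey1980, 2.2.4] -/
theorem length_faces_flatten : (faces act R₀).flatten.length = Fintype.card A * R₀.length := by
  rw [faces, length_flatten, map_map]
  have : (List.length ∘ liftAt act R₀) = fun _ => R₀.length := by
    funext b; exact length_liftAt act R₀ b
  rw [this, map_const', sum_replicate, Finset.length_toList, Finset.card_univ, smul_eq_mul]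

/-- **Every edge letter lies on some lifted face** (when `R₀` is duplicate-free and uses every
letter of `X`): the covering complex is closed. [cite: ZieschangVogtColdewey1980, 2.2.4] -/
theorem mem_faces_flatten [Fintype X] [DecidableEq X] [DecidableEq A] (hd : R₀.Nodup)
    (hall : ∀ β : X × Bool, β ∈ R₀) (l : (X × A) × Bool) : l ∈ (faces act R₀).flatten := by
  classical
  have hR : R₀.length = Fintype.card (X × Bool) := by
    rw [← List.toFinset_card_of_nodup hd, Finset.eq_univ_of_forall fun β => List.mem_toFinset.2 (hall β),
      Finset.card_univ]
  have hcard : (faces act R₀).flatten.toFinset = Finset.univ := by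
    apply Finset.eq_univ_of_card
    rw [List.toFinset_card_of_nodup (nodup_faces_flatten act hd), length_faces_flatten, hR,
      Fintype.card_prod, Fintype.card_prod, Fintype.card_prod]
    ring
  have := Finset.mem_univ l
  rw [← hcard, List.mem_toFinset] at this
  exact this

/-- The system of lifted faces is closed under reversal of edges. [cite: ZieschangVogtColdewey1980, 2.2.4] -/
theorem closed_faces_flatten [Fintype X] [DecidableEq X] [DecidableEq A] (hd : R₀.Nodup)
    (hall : ∀ β : X × Bool, β ∈ R₀) : Closed (faces act R₀).flatten :=
  fun l _ => mem_faces_flatten act hd hall (bar l)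

/-! ### The vertices of the covering -/

variable [DecidableEq X] [DecidableEq A]

omit [Fintype A] in
/-- **Along a lifted face, the successor of a letter ends where the letter starts** (the face
closes up because `R₀` acts trivially). [cite: ZieschangVogtColdewey1980, 3.1.2] -/
theorem fin_formPerm_liftAt (hd : R₀.Nodup) (hR0 : R₀ ≠ []) (htriv : act (FreeGroup.mk R₀) = 1)
    (b : A) {u : (X × A) × Bool} (hu : u ∈ liftAt act R₀ b) :
    fin act ((liftAt act R₀ b).formPerm u) = ini act u := by
  have hdF : (liftAt act R₀ b).Nodup := nodup_liftAt act hd b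
  have hF0 : liftAt act R₀ b ≠ [] := ne_nil_of_mem hu
  by_cases hlast : u = (liftAt act R₀ b).getLast hF0
  · rw [hlast, formPerm_apply_getLast' _ hF0, fin_head_liftAt act hR0, ini_getLast_liftAt, map_inv, htriv,
      inv_one, Perm.one_apply]
  · obtain ⟨P, u', Q, hPQ⟩ := exists_split_succ hu fun _ => hlast
    rw [hPQ, formPerm_apply_mid P Q u u' (hPQ ▸ hdF)]
    exact fin_eq_ini_of_liftAt_eq act R₀ b P Q u u' hPQ

omit [Fintype A] in
/-- **Along a lifted face, successors cover successors of the base word.**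
[cite: ZieschangVogtColdewey1980, 3.1.2] -/
theorem proj_formPerm_liftAt (hd : R₀.Nodup) (hR0 : R₀ ≠ []) (b : A) {u : (X × A) × Bool}
    (hu : u ∈ liftAt act R₀ b) : proj ((liftAt act R₀ b).formPerm u) = R₀.formPerm (proj u) := by
  have hdF : (liftAt act R₀ b).Nodup := nodup_liftAt act hd b
  have hF0 : liftAt act R₀ b ≠ [] := ne_nil_of_mem hu
  by_cases hlast : u = (liftAt act R₀ b).getLast hF0
  · rw [hlast, formPerm_apply_getLast' _ hF0, proj_getLast_liftAt act b hF0 hR0, formPerm_apply_getLast' _ hR0,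
      proj_head_liftAt act b hF0 hR0]
  · obtain ⟨P, u', Q, hPQ⟩ := exists_split_succ hu fun _ => hlast
    have hR : R₀ = P.map proj ++ proj u :: proj u' :: Q.map proj := by
      have := map_proj_liftAt act R₀ b
      rw [hPQ, map_append, map_cons, map_cons] at this
      exact this.symm
    rw [hPQ, formPerm_apply_mid P Q u u' (hPQ ▸ hdF)]
    conv_rhs => rw [hR]
    rw [formPerm_apply_mid _ _ _ _ (hR ▸ hd)]

/-- **The vertex permutation of the covering preserves the end vertex.**
[cite: ZieschangVogtColdewey1980, 3.1.2] -/
theorem fin_sysPerm [Fintype X] (hd : R₀.Nodup) (hall : ∀ β : X × Bool, β ∈ R₀)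
    (htriv : act (FreeGroup.mk R₀) = 1) (l : (X × A) × Bool) :
    fin act (sysPerm (faces act R₀) l) = fin act l := by
  have hR0 : R₀ ≠ [] := ne_nil_of_mem (hall (l.1.1, true))
  obtain ⟨F, hF, hu⟩ := mem_flatten.1 (mem_faces_flatten act hd hall (bar l))
  obtain ⟨b, rfl⟩ := (mem_faces act).1 hF
  rw [sysPerm_apply_of_bar_mem (nodup_faces_flatten act hd) hF hu, fin_formPerm_liftAt act hd hR0 htriv b hu,
    ini_bar]

/-- **The vertex permutation of the covering covers the vertex permutation of the base word.**
[cite: ZieschangVogtColdewey1980, 3.1.2] -/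
theorem proj_sysPerm [Fintype X] (hd : R₀.Nodup) (hall : ∀ β : X × Bool, β ∈ R₀)
    (l : (X × A) × Bool) : proj (sysPerm (faces act R₀) l) = vertexPerm R₀ (proj l) := by
  have hR0 : R₀ ≠ [] := ne_nil_of_mem (hall (l.1.1, true))
  obtain ⟨F, hF, hu⟩ := mem_flatten.1 (mem_faces_flatten act hd hall (bar l))
  obtain ⟨b, rfl⟩ := (mem_faces act).1 hF
  rw [sysPerm_apply_of_bar_mem (nodup_faces_flatten act hd) hF hu, vertexPerm_apply, ← proj_bar,
    proj_formPerm_liftAt act hd hR0 b hu]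

/-- **The vertices of the covering are the fibres of the end-vertex map**: if `R₀` is a
duplicate-free one-vertex word using every letter and acting trivially, two edge letters lie in
one cycle of the vertex permutation of the lifted faces iff they end at the same vertex of `A` —
the covering complex has exactly one vertex over each point of `A`.
[cite: ZieschangVogtColdewey1980, 3.1.2] -/
theorem sameCycle_sysPerm_faces_iff [Fintype X] (hd : R₀.Nodup) (hall : ∀ β : X × Bool, β ∈ R₀)
    (htriv : act (FreeGroup.mk R₀) = 1) (hV : VertexTransitive R₀) (l l' : (X × A) × Bool) :
    (sysPerm (faces act R₀)).SameCycle l l' ↔ fin act l = fin act l' := by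
  constructor
  · rintro ⟨n, rfl⟩
    -- `fin` is invariant under all (integer) powers
    have key : ∀ (n : ℕ) (m : (X × A) × Bool), fin act ((sysPerm (faces act R₀) ^ n) m) = fin act m := by
      intro n
      induction n with
      | zero => intro m; rfl
      | succ n ih => intro m; rw [pow_succ', Perm.mul_apply, fin_sysPerm act hd hall htriv, ih]
    obtain ⟨k, hk⟩ := SameCycle.exists_nat_pow_eq (f := sysPerm (faces act R₀)) (x := l) ⟨n, rfl⟩
    rw [← hk, key]
  · intro h
    obtain ⟨n, hn⟩ := (hV (proj l) (hall _) (proj l') (hall _)).exists_nat_pow_eq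
    have key : ∀ (n : ℕ), proj ((sysPerm (faces act R₀) ^ n) l) = (vertexPerm R₀ ^ n) (proj l) ∧
        fin act ((sysPerm (faces act R₀) ^ n) l) = fin act l := by
      intro n
      induction n with
      | zero => exact ⟨rfl, rfl⟩
      | succ n ih =>
        rw [pow_succ', Perm.mul_apply, pow_succ', Perm.mul_apply, proj_sysPerm act hd hall,
          fin_sysPerm act hd hall htriv, ih.1, ih.2]
        exact ⟨rfl, rfl⟩
    have heq : (sysPerm (faces act R₀) ^ n) l = l' :=
      ext_of_proj_fin act (by rw [(key n).1, hn]) (by rw [(key n).2, h])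
    exact ⟨(n : ℤ), by rw [zpow_natCast]; exact heq⟩

end System

end CoveringPresentation

end Literature.GroupTheory.CombinatorialGroupTheory
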